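import Summits.CriticalPhenomena.SAWScalingLimit.Theorems.SAWLoopFugacityFlowIsingBoundaryRatioFrameDefs
import Summits.CriticalPhenomena.SAWScalingLimit.Theorems.SAWLoopFugacityFlowIsingBoundaryRatioRoughHalfAnnulusRSWPath
import Literature.Probability.LatticeModels.RandomClusterRegionToAnnulus
import HarnessLib

/-!
# The chart frame versus the line's half-annulus vocabulary: transfer lemmas
(line `fk-anchor-transfer`, crux `SAWLoopFugacityFlow.IsingBoundaryRatio`, stmt-CriticalPhenomena-10650)

Companion of `…IsingBoundaryRatioFrameDefs.lean` (the scale frame `chartFrame D φ ε δ Λ H η R hη hadj` of a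
finite volume `Λ` read through the chordal chart) and `…IsingBoundaryRatioFrameLadder.lean` (the RSW ladder of
the frame). Here the frame vocabulary (`inSet`, `annSet`, `outSet`, `edgesTouching`, `radCross`, `sepEvent`,
`SepBound`, `NoCrossBound`, `RadialBound` of `Literature.Probability.LatticeModels.ScaleFrame`) is compared
with the line's vocabulary (`annIn`, `annBody`, `annEdgeFinset`, `AnnCross`, `AnnPathSepG`) for the MESH graph
`H₀ = Ω_δ.comap val` on `↥Λ`, under the hypothesis that `H` and `H₀` have the same edges at the sites of `Λ`
whose mesh point lies in the ball `B(a, ε)` (which is what `LocalAgreement` gives for `H = G.comap val`):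

* the frame regions are the line's regions intersected with the mesh sites (`mem_chartFrame_inSet_iff`,
  `mem_chartFrame_annSet_iff`); non-mesh ("junk") sites carry no edge of `H₀`;
* the edges of the frame touching its annulus are the edges of `H₀` touching `annBody`
  (`chartFrame_edgesTouching_annSet`);
* wiring the complement of the frame annulus or the complement of `annBody` gives the same local
  random-cluster probabilities (the difference consists of isolated vertices, `rcMeasure_real_union_isolated`);
* the frame's radial crossing event IS the line's `AnnCross` for `H₀` (`chartFrame_radCross_iff_annCross`), and
  the line's guarded path separation `AnnPathSepG` for `H₀` implies the frame's `sepEvent`;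
* hence the three RSW predicates of the frame follow from the corresponding mesh-graph bounds
  (`chartFrame_sepBound_of_mesh`, `chartFrame_noCrossBound_of_mesh`, `chartFrame_radialBound_of_mesh`).

Everything is elementary bookkeeping (walk transfer between graphs agreeing near the annulus); no probability
beyond monotonicity of measures. [folklore]
-/

noncomputable section

open scoped Classical Topology
open Filter Set Metric SimpleGraph MeasureTheory
open Literature.Probability.LatticeModels Literature.Probability.RandomPlanarGeometry
open Literature.Probability.Percolation (BondConfig openConnIn openGraph)
open UpperHalfPlane (upperHalfPlaneSet)

namespace Summit.CriticalPhenomena.SAWScalingLimit.Theorems.IsingBoundaryRatio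

/-! ### Generic graph facts -/

/-- Two graphs with the same edges at a vertex `v` have the same edges containing `v`. [folklore] -/
theorem mem_edgeSet_iff_of_agree_at {V : Type*} {H H' : SimpleGraph V} {e : Sym2 V} {v : V} (hve : v ∈ e)
    (hag : ∀ w, H.Adj v w ↔ H'.Adj v w) : e ∈ H.edgeSet ↔ e ∈ H'.edgeSet := by
  obtain ⟨w, rfl⟩ : ∃ w, e = s(v, w) := ⟨Sym2.Mem.other hve, (Sym2.other_spec hve).symm⟩
  rw [mem_edgeSet, mem_edgeSet]
  exact hag w

section Frame

variable {D : DobrushinDomain} {φ : ConformalEquiv upperHalfPlaneSet D.carrier} {ε δ : ℝ}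
  {Λ : Finset (Site 2)} {H : SimpleGraph Λ} {η R : ℝ} {hη : 0 < η}
  {hadj : ∀ e ∈ H.edgeFinset, ∀ u ∈ e, ∀ v ∈ e,
      (u.1 ∈ meshDomain D.carrier δ ∧ meshPoint δ u.1 ∈ Metric.ball (D.pt 0) ε) →
      ‖φ.symm (meshPoint δ u.1)‖ < R →
        (v.1 ∈ meshDomain D.carrier δ ∧ meshPoint δ v.1 ∈ Metric.ball (D.pt 0) ε) ∧
          |‖φ.symm (meshPoint δ v.1)‖ - ‖φ.symm (meshPoint δ u.1)‖| < η}

/-! ### The mesh graph on the volume: its edges live on mesh sites -/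

/-- An edge of `Ω_δ.comap val` joins two MESH sites. [folklore] -/
theorem mesh_of_meshComap_adj {x y : Λ}
    (h : ((discreteDomainGraph D.carrier δ).comap (Subtype.val : Λ → Site 2)).Adj x y) :
    x.1 ∈ meshDomain D.carrier δ ∧ y.1 ∈ meshDomain D.carrier δ := by
  rw [comap_adj] at h
  exact (discreteDomainGraph_adj_iff.1 h).2

/-- A vertex of an edge of `Ω_δ.comap val` is a mesh site. [folklore] -/
theorem mesh_of_mem_edgeSet_meshComap {e : Sym2 Λ}
    (he : e ∈ ((discreteDomainGraph D.carrier δ).comap (Subtype.val : Λ → Site 2)).edgeSet) {z : Λ}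
    (hz : z ∈ e) : z.1 ∈ meshDomain D.carrier δ := by
  obtain ⟨w, rfl⟩ : ∃ w, e = s(z, w) := ⟨Sym2.Mem.other hz, (Sym2.other_spec hz).symm⟩
  exact (mesh_of_meshComap_adj ((mem_edgeSet _).1 he)).1

/-- Every vertex of a walk of positive length in `Ω_δ.comap val` is a mesh site. [folklore] -/
theorem mesh_of_mem_support_meshComap {u v : Λ}
    (p : ((discreteDomainGraph D.carrier δ).comap (Subtype.val : Λ → Site 2)).Walk u v) (hp : ¬ p.Nil)
    {z : Λ} (hz : z ∈ p.support) : z.1 ∈ meshDomain D.carrier δ := by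
  obtain ⟨e, he, hze⟩ := (Walk.mem_support_iff_exists_mem_edges_of_not_nil hp).1 hz
  exact mesh_of_mem_edgeSet_meshComap (p.edges_subset_edgeSet he) hze

/-- Local agreement of `(G, Λ)` with `Ω_δ` in `B(a, ε)`: `G.comap val` and `Ω_δ.comap val` have the same
edges at every site of `Λ` whose mesh point lies in the ball. [folklore] -/
theorem comap_adj_iff_meshComap_adj_of_localAgreement {G : SimpleGraph (Site 2)}
    (hLA : LocalAgreement D.carrier (D.pt 0) ε δ G Λ) :
    ∀ u : Λ, meshPoint δ u.1 ∈ Metric.ball (D.pt 0) ε → ∀ v : Λ,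
      (G.comap (Subtype.val : Λ → Site 2)).Adj u v ↔
        ((discreteDomainGraph D.carrier δ).comap (Subtype.val : Λ → Site 2)).Adj u v :=
  fun u hu v => by rw [comap_adj, comap_adj]; exact (hLA u.1 u.2 hu v.1).1

/-! ### The regions of the chart frame -/

/-- Adjacency in the graph of the chart frame is adjacency in `H`. [folklore] -/
theorem chartFrame_graph_adj {x y : Λ} :
    (chartFrame D φ ε δ Λ H η R hη hadj).graph.Adj x y ↔ H.Adj x y := by
  rw [ScaleFrame.graph, fromEdgeSet_adj, chartFrame_E, Finset.mem_coe, mem_edgeFinset, mem_edgeSet]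
  exact ⟨fun h => h.1, fun h => ⟨h, h.ne⟩⟩

/-- The inside of the chart frame: mesh sites of the line's `annIn`. [folklore] -/
theorem mem_chartFrame_inSet_iff {s : ℝ} {v : Λ} :
    v ∈ (chartFrame D φ ε δ Λ H η R hη hadj).inSet s ↔ v ∈ annIn D φ ε δ s Λ ∧ v.1 ∈ meshDomain D.carrier δ := by
  rw [ScaleFrame.mem_inSet, mem_chartFrame_good, chartFrame_rad]
  exact ⟨fun ⟨⟨h1, h2⟩, h3⟩ => ⟨⟨h2, h3⟩, h1⟩, fun ⟨⟨h2, h3⟩, h1⟩ => ⟨⟨h1, h2⟩, h3⟩⟩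

/-- The annulus of the chart frame with radii `(s, M' s)`: mesh sites of the line's `annBody` of modulus `M'`
and scale `s`. [folklore] -/
theorem mem_chartFrame_annSet_iff {M' s s' : ℝ} (hs : M' * s = s') {v : Λ} :
    v ∈ (chartFrame D φ ε δ Λ H η R hη hadj).annSet s s' ↔
      v ∈ annBody D φ M' ε δ s Λ ∧ v.1 ∈ meshDomain D.carrier δ := by
  rw [ScaleFrame.mem_annSet, mem_chartFrame_good, chartFrame_rad, ← hs]
  exact ⟨fun ⟨⟨h1, h2⟩, h3, h4⟩ => ⟨⟨h2, h3, h4⟩, h1⟩, fun ⟨⟨h2, h3, h4⟩, h1⟩ => ⟨⟨h1, h2⟩, h3, h4⟩⟩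

/-- The inside of the chart frame lies in `annIn`. [folklore] -/
theorem chartFrame_inSet_subset_annIn {s : ℝ} :
    (chartFrame D φ ε δ Λ H η R hη hadj).inSet s ⊆ annIn D φ ε δ s Λ :=
  fun _ hv => (mem_chartFrame_inSet_iff.1 hv).1

/-- A vertex of the inside or of the annulus of the chart frame has its mesh point in the ball. [folklore] -/
theorem ball_of_mem_chartFrame_inSet_union_annSet {s s' : ℝ} {v : Λ}
    (hv : v ∈ (chartFrame D φ ε δ Λ H η R hη hadj).inSet s ∪ (chartFrame D φ ε δ Λ H η R hη hadj).annSet s s') :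
    meshPoint δ v.1 ∈ Metric.ball (D.pt 0) ε := by
  rcases hv with hv | hv
  · exact ((ScaleFrame.mem_inSet _).1 hv).1.2
  · exact ((ScaleFrame.mem_annSet _).1 hv).1.2

/-- Under agreement in the ball, the graph of the chart frame and `Ω_δ.comap val` have the same edges at the
sites of the inside and of the annulus of the frame. [folklore] -/
theorem chartFrame_graph_adj_iff_meshComap_adj
    (hag : ∀ u : Λ, meshPoint δ u.1 ∈ Metric.ball (D.pt 0) ε → ∀ v : Λ,
      H.Adj u v ↔ ((discreteDomainGraph D.carrier δ).comap (Subtype.val : Λ → Site 2)).Adj u v)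
    {s s' : ℝ} :
    ∀ u ∈ (chartFrame D φ ε δ Λ H η R hη hadj).inSet s ∪ (chartFrame D φ ε δ Λ H η R hη hadj).annSet s s',
      ∀ v : Λ, (chartFrame D φ ε δ Λ H η R hη hadj).graph.Adj u v ↔
        ((discreteDomainGraph D.carrier δ).comap (Subtype.val : Λ → Site 2)).Adj u v :=
  fun _ hu v => chartFrame_graph_adj.trans (hag _ (ball_of_mem_chartFrame_inSet_union_annSet hu) v)

/-! ### Edge sets -/

/-- **The edges of the frame touching its annulus `(s, M' s)` are the edges of the mesh graph touching
`annBody` of modulus `M'` and scale `s`** (an `annBody`-vertex on an edge of either graph is a mesh site in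
the ball, where the two graphs agree). [folklore] -/
theorem chartFrame_edgesTouching_annSet
    (hag : ∀ u : Λ, meshPoint δ u.1 ∈ Metric.ball (D.pt 0) ε → ∀ v : Λ,
      H.Adj u v ↔ ((discreteDomainGraph D.carrier δ).comap (Subtype.val : Λ → Site 2)).Adj u v)
    {M' s s' : ℝ} (hs : M' * s = s') :
    (chartFrame D φ ε δ Λ H η R hη hadj).edgesTouching ((chartFrame D φ ε δ Λ H η R hη hadj).annSet s s') =
      annEdgeFinset ((discreteDomainGraph D.carrier δ).comap (Subtype.val : Λ → Site 2))
        (annBody D φ M' ε δ s Λ) := by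
  ext e
  rw [ScaleFrame.mem_edgesTouching, chartFrame_E, mem_edgeFinset, mem_annEdgeFinset]
  constructor
  · rintro ⟨he, v, hve, hv⟩
    have hv' := (mem_chartFrame_annSet_iff hs).1 hv
    exact ⟨(mem_edgeSet_iff_of_agree_at hve (hag v hv'.1.1)).1 he, v, hv'.1, hve⟩
  · rintro ⟨he, v, hv, hve⟩
    have hmesh := mesh_of_mem_edgeSet_meshComap he hve
    exact ⟨(mem_edgeSet_iff_of_agree_at hve (hag v hv.1)).2 he, v, hve,
      (mem_chartFrame_annSet_iff hs).2 ⟨hv, hmesh⟩⟩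

/-! ### Wired sets: junk sites are isolated -/

/-- The complement of the frame annulus is the complement of `annBody` together with the junk (non-mesh)
sites of `annBody`. [folklore] -/
theorem chartFrame_compl_annSet_eq {M' s s' : ℝ} (hs : M' * s = s') :
    ((chartFrame D φ ε δ Λ H η R hη hadj).annSet s s')ᶜ =
      (annBody D φ M' ε δ s Λ)ᶜ ∪
        ↑(Finset.univ.filter fun v : Λ => v ∈ annBody D φ M' ε δ s Λ ∧ v.1 ∉ meshDomain D.carrier δ) := by
  ext v
  rw [Set.mem_compl_iff, mem_chartFrame_annSet_iff hs, Set.mem_union, Set.mem_compl_iff, Finset.coe_filter,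
    Set.mem_setOf_eq]
  simp only [Finset.mem_univ, true_and]
  tauto

/-- Junk sites of `Ann` meet no edge of the local graph `⟨annEdgeFinset H₀ Ann⟩` of the mesh graph. [folklore] -/
theorem not_adj_of_mem_junk (Ann : Set Λ) :
    ∀ v ∈ (Finset.univ.filter fun v : Λ => v ∈ Ann ∧ v.1 ∉ meshDomain D.carrier δ), ∀ w : Λ,
      ¬ (fromEdgeSet (↑(annEdgeFinset ((discreteDomainGraph D.carrier δ).comap (Subtype.val : Λ → Site 2)) Ann) :
        Set (Sym2 Λ))).Adj v w := by
  intro v hv w hadj'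
  rw [Finset.mem_filter] at hv
  rw [fromEdgeSet_adj, Finset.mem_coe, mem_annEdgeFinset] at hadj'
  exact hv.2.2 (mesh_of_meshComap_adj ((mem_edgeSet _).1 hadj'.1.1)).1

/-- **Wiring the complement of the frame annulus or the complement of `annBody` gives the same local
probabilities**: the two wired sets differ by vertices isolated in the local graph. [folklore] -/
theorem chartFrame_rcMeasure_compl_annSet {M' s s' : ℝ} (hs : M' * s = s') {p q : ℝ} (hp : p ∈ Set.Icc (0 : ℝ) 1)
    (hq : 0 < q) (A : Set (BondConfig Λ)) :
    (rcMeasure (fromEdgeSet (↑(annEdgeFinset ((discreteDomainGraph D.carrier δ).comap (Subtype.val : Λ → Site 2))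
        (annBody D φ M' ε δ s Λ)) : Set (Sym2 Λ))) p q ((chartFrame D φ ε δ Λ H η R hη hadj).annSet s s')ᶜ).real A =
      (rcMeasure (fromEdgeSet (↑(annEdgeFinset ((discreteDomainGraph D.carrier δ).comap (Subtype.val : Λ → Site 2))
        (annBody D φ M' ε δ s Λ)) : Set (Sym2 Λ))) p q (annBody D φ M' ε δ s Λ)ᶜ).real A := by
  rw [chartFrame_compl_annSet_eq hs]
  exact rcMeasure_real_union_isolated _ hp hq _ _ (not_adj_of_mem_junk _) A

/-! ### Walks and events -/

/-- **A walk of the frame graph from the inside to the outside of the frame annulus `(s, M' s)` contains a walk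
of the mesh graph from `annIn` to the complement of `annIn ∪ annBody`** (its prefix up to the first exit from
inside-and-annulus: all earlier vertices are mesh sites in the ball, where the graphs agree, and the exit vertex,
the far end of a mesh edge, is a mesh site, hence outside `annIn ∪ annBody`). [folklore] -/
theorem exists_meshWalk_of_chartFrame_walk
    (hag : ∀ u : Λ, meshPoint δ u.1 ∈ Metric.ball (D.pt 0) ε → ∀ v : Λ,
      H.Adj u v ↔ ((discreteDomainGraph D.carrier δ).comap (Subtype.val : Λ → Site 2)).Adj u v)
    {M' s s' : ℝ} (hs : M' * s = s') {a b : Λ} (w : (chartFrame D φ ε δ Λ H η R hη hadj).graph.Walk a b)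
    (ha : a ∈ (chartFrame D φ ε δ Λ H η R hη hadj).inSet s)
    (hb : b ∈ (chartFrame D φ ε δ Λ H η R hη hadj).outSet s s') :
    ∃ (b' : Λ) (q : ((discreteDomainGraph D.carrier δ).comap (Subtype.val : Λ → Site 2)).Walk a b'),
      a ∈ annIn D φ ε δ s Λ ∧ b' ∉ annIn D φ ε δ s Λ ∪ annBody D φ M' ε δ s Λ ∧ q.support ⊆ w.support := by
  obtain ⟨b', q, hb', hd, hsub⟩ :=
    exists_prefix_darts (fun z => z ∈ (chartFrame D φ ε δ Λ H η R hη hadj).inSet s ∪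
      (chartFrame D φ ε δ Λ H η R hη hadj).annSet s s') w ((ScaleFrame.mem_outSet _).1 hb)
  obtain ⟨q', hq's, -⟩ := exists_walk_of_darts
    (G' := (discreteDomainGraph D.carrier δ).comap (Subtype.val : Λ → Site 2)) q fun d hdq =>
      (chartFrame_graph_adj_iff_meshComap_adj hag _ (hd d hdq) _).1 d.adj
  have hne : a ≠ b' := fun hab => hb' (hab ▸ Or.inl ha)
  have hmesh : b'.1 ∈ meshDomain D.carrier δ :=
    mesh_of_mem_support_meshComap q' (Walk.not_nil_of_ne hne) q'.end_mem_support
  refine ⟨b', q', chartFrame_inSet_subset_annIn ha, fun h => hb' ?_, fun z hz => hsub (hq's ▸ hz)⟩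
  exact h.imp (fun h => mem_chartFrame_inSet_iff.2 ⟨h, hmesh⟩) fun h => (mem_chartFrame_annSet_iff hs).2 ⟨h, hmesh⟩

/-- **The guarded path separation of the mesh half-annulus gives the frame's separator event**: the support
of the open mesh walk inside `annBody` consists of mesh sites (it meets a linking walk, whose vertices are mesh
sites, and is connected), so it lies in the frame annulus, is pairwise open-connected there, and meets every
frame walk from the inside to the outside through `exists_meshWalk_of_chartFrame_walk`; without a link there
is no such frame walk and the empty separator does. [folklore] -/
theorem chartFrame_sepEvent_of_annPathSepG
    (hag : ∀ u : Λ, meshPoint δ u.1 ∈ Metric.ball (D.pt 0) ε → ∀ v : Λ,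
      H.Adj u v ↔ ((discreteDomainGraph D.carrier δ).comap (Subtype.val : Λ → Site 2)).Adj u v)
    {M' s s' : ℝ} (hs : M' * s = s') {ω : BondConfig Λ}
    (h : AnnPathSepG ((discreteDomainGraph D.carrier δ).comap (Subtype.val : Λ → Site 2))
      (annIn D φ ε δ s Λ) (annBody D φ M' ε δ s Λ) ω) :
    ω ∈ (chartFrame D φ ε δ Λ H η R hη hadj).sepEvent s s' := by
  by_cases hlink : AnnLink ((discreteDomainGraph D.carrier δ).comap (Subtype.val : Λ → Site 2))
      (annIn D φ ε δ s Λ) (annBody D φ M' ε δ s Λ)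
  · obtain ⟨u, v, p, hsupp, hopen, hcut⟩ := h hlink
    have hmesh : ∀ z ∈ p.support, z.1 ∈ meshDomain D.carrier δ := by
      intro z hz
      by_cases hp : p.Nil
      · rw [Walk.nil_iff_support_eq.1 hp, List.mem_singleton] at hz
        subst hz
        obtain ⟨a, b, q, ha, hb⟩ := hlink
        obtain ⟨z₀, hz₀q, hz₀p⟩ := hcut a b ha hb q
        rw [Walk.nil_iff_support_eq.1 hp, List.mem_singleton] at hz₀p
        have hne : a ≠ b := fun hab => hb (Or.inl (hab ▸ ha))
        exact hz₀p ▸ mesh_of_mem_support_meshComap q (Walk.not_nil_of_ne hne) hz₀q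
      · exact mesh_of_mem_support_meshComap p hp hz
    have hsupp' : ∀ z ∈ p.support, z ∈ (chartFrame D φ ε δ Λ H η R hη hadj).annSet s s' := fun z hz =>
      (mem_chartFrame_annSet_iff hs).2 ⟨hsupp z hz, hmesh z hz⟩
    refine ⟨{z | z ∈ p.support}, fun z hz => hsupp' z hz, fun x hx y hy => ?_, fun a b ha hb w => ?_⟩
    · obtain ⟨_hu₁, hx', hrx⟩ := openConnIn_of_walk p hsupp' hopen x hx
      obtain ⟨_hu₂, hy', hry⟩ := openConnIn_of_walk p hsupp' hopen y hy
      exact ⟨hx', hy', hrx.symm.trans hry⟩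
    · obtain ⟨b', q, ha', hb', hsub⟩ := exists_meshWalk_of_chartFrame_walk hag hs w ha hb
      obtain ⟨z, hzq, hzp⟩ := hcut a b' ha' hb' q
      exact ⟨z, hsub hzq, hzp⟩
  · refine ⟨∅, Set.empty_subset _, fun x hx => absurd hx (Set.notMem_empty x), fun a b ha hb w => ?_⟩
    obtain ⟨b', q, ha', hb', -⟩ := exists_meshWalk_of_chartFrame_walk hag hs w ha hb
    exact absurd ⟨a, b', q, ha', hb'⟩ hlink

/-- The frame's radial crossing event is the line's `AnnCross` for the frame graph and the frame regions
(definitional). [folklore] -/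
theorem mem_chartFrame_radCross_iff {s s' : ℝ} {ω : BondConfig Λ} :
    ω ∈ (chartFrame D φ ε δ Λ H η R hη hadj).radCross s s' ↔
      AnnCross (chartFrame D φ ε δ Λ H η R hη hadj).graph ((chartFrame D φ ε δ Λ H η R hη hadj).inSet s)
        ((chartFrame D φ ε δ Λ H η R hη hadj).annSet s s') ω :=
  Iff.rfl

/-- **`AnnCross` of the mesh graph for the frame regions `(inSet s, annSet s (M' s))` and for the line's regions
`(annIn s, annBody M' s)` coincide**: the vertices of a crossing walk (of positive length) are mesh sites.
[folklore] -/
theorem annCross_meshComap_chartFrame_iff {M' s s' : ℝ} (hs : M' * s = s') {ω : BondConfig Λ} :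
    AnnCross ((discreteDomainGraph D.carrier δ).comap (Subtype.val : Λ → Site 2))
        ((chartFrame D φ ε δ Λ H η R hη hadj).inSet s) ((chartFrame D φ ε δ Λ H η R hη hadj).annSet s s') ω ↔
      AnnCross ((discreteDomainGraph D.carrier δ).comap (Subtype.val : Λ → Site 2))
        (annIn D φ ε δ s Λ) (annBody D φ M' ε δ s Λ) ω := by
  constructor
  · rintro ⟨a, b, p, ha, hb, hsupp, hopen⟩
    have hne : a ≠ b := fun hab => hb (Or.inl (hab ▸ ha))
    have hbm : b.1 ∈ meshDomain D.carrier δ :=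
      mesh_of_mem_support_meshComap p (Walk.not_nil_of_ne hne) p.end_mem_support
    refine ⟨a, b, p, chartFrame_inSet_subset_annIn ha, fun h => hb ?_, fun z hz => ?_, hopen⟩
    · exact h.imp (fun h => mem_chartFrame_inSet_iff.2 ⟨h, hbm⟩) fun h => (mem_chartFrame_annSet_iff hs).2 ⟨h, hbm⟩
    · exact (hsupp z hz).imp id (Or.imp id fun h => ((mem_chartFrame_annSet_iff hs).1 h).1)
  · rintro ⟨a, b, p, ha, hb, hsupp, hopen⟩
    have hne : a ≠ b := fun hab => hb (Or.inl (hab ▸ ha))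
    have hm : ∀ z ∈ p.support, z.1 ∈ meshDomain D.carrier δ := fun z hz =>
      mesh_of_mem_support_meshComap p (Walk.not_nil_of_ne hne) hz
    refine ⟨a, b, p, mem_chartFrame_inSet_iff.2 ⟨ha, hm a p.start_mem_support⟩, fun h => hb ?_,
      fun z hz => ?_, hopen⟩
    · exact h.imp (fun h => chartFrame_inSet_subset_annIn h) fun h => ((mem_chartFrame_annSet_iff hs).1 h).1
    · exact (hsupp z hz).imp id (Or.imp id fun h => (mem_chartFrame_annSet_iff hs).2 ⟨h, hm z hz⟩)

/-- **The frame's radial crossing of `(s, M' s)` is the mesh graph's `AnnCross` of `(annIn s, annBody M' s)`**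
(walk transfer at the sites of inside-and-annulus, `annCross_of_agree`, in both directions). [folklore] -/
theorem chartFrame_radCross_iff_annCross
    (hag : ∀ u : Λ, meshPoint δ u.1 ∈ Metric.ball (D.pt 0) ε → ∀ v : Λ,
      H.Adj u v ↔ ((discreteDomainGraph D.carrier δ).comap (Subtype.val : Λ → Site 2)).Adj u v)
    {M' s s' : ℝ} (hs : M' * s = s') {ω : BondConfig Λ} :
    ω ∈ (chartFrame D φ ε δ Λ H η R hη hadj).radCross s s' ↔
      AnnCross ((discreteDomainGraph D.carrier δ).comap (Subtype.val : Λ → Site 2))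
        (annIn D φ ε δ s Λ) (annBody D φ M' ε δ s Λ) ω := by
  rw [mem_chartFrame_radCross_iff, ← annCross_meshComap_chartFrame_iff (hη := hη) (hadj := hadj) hs]
  exact ⟨annCross_of_agree (chartFrame_graph_adj_iff_meshComap_adj hag),
    annCross_of_agree fun u hu v => (chartFrame_graph_adj_iff_meshComap_adj hag u hu v).symm⟩

/-! ### The three RSW predicates of the frame from mesh-graph bounds -/

/-- **Separator bound of the frame from the mesh bound**: the free local measure of the edges touching the
frame annulus `(s, M' s)` is the free local measure of `annEdgeFinset H₀ (annBody M' s)`, and `AnnPathSepG`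
implies `sepEvent`. [folklore] -/
theorem chartFrame_sepBound_of_mesh
    (hag : ∀ u : Λ, meshPoint δ u.1 ∈ Metric.ball (D.pt 0) ε → ∀ v : Λ,
      H.Adj u v ↔ ((discreteDomainGraph D.carrier δ).comap (Subtype.val : Λ → Site 2)).Adj u v)
    {M' s s' : ℝ} (hs : M' * s = s') {p q c : ℝ} (hp : p ∈ Set.Icc (0 : ℝ) 1) (hq : 0 < q)
    (h : c ≤ (rcMeasure (fromEdgeSet (↑(annEdgeFinset ((discreteDomainGraph D.carrier δ).comap
        (Subtype.val : Λ → Site 2)) (annBody D φ M' ε δ s Λ)) : Set (Sym2 Λ))) p q ∅).real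
        {ω | AnnPathSepG ((discreteDomainGraph D.carrier δ).comap (Subtype.val : Λ → Site 2))
          (annIn D φ ε δ s Λ) (annBody D φ M' ε δ s Λ) ω}) :
    (chartFrame D φ ε δ Λ H η R hη hadj).SepBound p q c s s' := by
  unfold ScaleFrame.SepBound
  rw [chartFrame_edgesTouching_annSet hag hs]
  haveI := isProbabilityMeasure_rcMeasure (fromEdgeSet (↑(annEdgeFinset ((discreteDomainGraph D.carrier δ).comap
    (Subtype.val : Λ → Site 2)) (annBody D φ M' ε δ s Λ)) : Set (Sym2 Λ))) hp hq ∅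
  exact h.trans (measureReal_mono fun ω hω => chartFrame_sepEvent_of_annPathSepG hag hs hω)

/-- **No-crossing bound of the frame from the mesh bound**: same local graph, wired sets differing by isolated
junk sites, and `radCross = AnnCross`. [folklore] -/
theorem chartFrame_noCrossBound_of_mesh
    (hag : ∀ u : Λ, meshPoint δ u.1 ∈ Metric.ball (D.pt 0) ε → ∀ v : Λ,
      H.Adj u v ↔ ((discreteDomainGraph D.carrier δ).comap (Subtype.val : Λ → Site 2)).Adj u v)
    {M' s s' : ℝ} (hs : M' * s = s') {p q c : ℝ} (hp : p ∈ Set.Icc (0 : ℝ) 1) (hq : 0 < q)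
    (h : (rcMeasure (fromEdgeSet (↑(annEdgeFinset ((discreteDomainGraph D.carrier δ).comap
        (Subtype.val : Λ → Site 2)) (annBody D φ M' ε δ s Λ)) : Set (Sym2 Λ))) p q (annBody D φ M' ε δ s Λ)ᶜ).real
        {ω | AnnCross ((discreteDomainGraph D.carrier δ).comap (Subtype.val : Λ → Site 2))
          (annIn D φ ε δ s Λ) (annBody D φ M' ε δ s Λ) ω} ≤ 1 - c) :
    (chartFrame D φ ε δ Λ H η R hη hadj).NoCrossBound p q c s s' := by
  unfold ScaleFrame.NoCrossBound
  rw [chartFrame_edgesTouching_annSet hag hs, chartFrame_rcMeasure_compl_annSet hs hp hq]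
  refine le_of_eq_of_le (congrArg _ (Set.ext fun ω => ?_)) h
  exact chartFrame_radCross_iff_annCross hag hs

/-- **Radial bound of the frame from the fattened mesh bound**: the free local measure of the edges touching
the fattened frame annulus `(s/2, 2 M' s)` is that of `annEdgeFinset H₀ (annBody (4M') (s/2))`, and
`AnnCross (annIn s) (annBody M' s)` is `radCross s (M' s)`. [folklore] -/
theorem chartFrame_radialBound_of_mesh
    (hag : ∀ u : Λ, meshPoint δ u.1 ∈ Metric.ball (D.pt 0) ε → ∀ v : Λ,
      H.Adj u v ↔ ((discreteDomainGraph D.carrier δ).comap (Subtype.val : Λ → Site 2)).Adj u v)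
    {M' s s' : ℝ} (hs : M' * s = s') {p q c : ℝ}
    (h : c ≤ (rcMeasure (fromEdgeSet (↑(annEdgeFinset ((discreteDomainGraph D.carrier δ).comap
        (Subtype.val : Λ → Site 2)) (annBody D φ (4 * M') ε δ (s / 2) Λ)) : Set (Sym2 Λ))) p q ∅).real
        {ω | AnnCross ((discreteDomainGraph D.carrier δ).comap (Subtype.val : Λ → Site 2))
          (annIn D φ ε δ s Λ) (annBody D φ M' ε δ s Λ) ω}) :
    (chartFrame D φ ε δ Λ H η R hη hadj).RadialBound p q c s s' := by
  unfold ScaleFrame.RadialBound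
  have hs2 : 4 * M' * (s / 2) = 2 * s' := by rw [← hs]; ring
  rw [chartFrame_edgesTouching_annSet hag hs2]
  refine h.trans (le_of_eq (congrArg _ (Set.ext fun ω => ?_)))
  exact (chartFrame_radCross_iff_annCross hag hs).symm

end Frame

/-! ### Head statement (registered sub-goal) -/

/-- **The frame's radial crossing event is the line's `AnnCross` of the mesh graph** (registered sub-goal of
stmt-CriticalPhenomena-10650): for a finite volume `(G, Λ)` agreeing locally with `Ω_δ` in `B(a, ε)`, the open
radial crossing of the annulus `(s, M' s)` of the chart frame of `G.comap val` is the event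
`AnnCross (Ω_δ.comap val) (annIn s) (annBody M' s)`. [folklore] -/
theorem chartFrame_radCross_eq_annCross : ∀ (D : DobrushinDomain) (φ : ConformalEquiv upperHalfPlaneSet D.carrier) (M' ε δ s : ℝ) (Λ : Finset (Site 2)) (G : SimpleGraph (Site 2)) (η R : ℝ) (hη : 0 < η) (hadj : ∀ e ∈ (G.comap (Subtype.val : ↥Λ → Site 2)).edgeFinset, ∀ u ∈ e, ∀ v ∈ e, (u.1 ∈ meshDomain D.carrier δ ∧ meshPoint δ u.1 ∈ Metric.ball (D.pt 0) ε) → ‖φ.symm (meshPoint δ u.1)‖ < R → (v.1 ∈ meshDomain D.carrier δ ∧ meshPoint δ v.1 ∈ Metric.ball (D.pt 0) ε) ∧ |‖φ.symm (meshPoint δ v.1)‖ - ‖φ.symm (meshPoint δ u.1)‖| < η), LocalAgreement D.carrier (D.pt 0) ε δ G Λ → (chartFrame D φ ε δ Λ (G.comap Subtype.val) η R hη hadj).radCross s (M' * s) = {ω | AnnCross ((discreteDomainGraph D.carrier δ).comap (Subtype.val : ↥Λ → Site 2)) (annIn D φ ε δ s Λ) (annBody D φ M' ε δ s Λ) ω}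 := by
  intro D φ M' ε δ s Λ G η R hη hadj hLA
  exact Set.ext fun ω => chartFrame_radCross_iff_annCross (comap_adj_iff_meshComap_adj_of_localAgreement hLA) rfl

end Summit.CriticalPhenomena.SAWScalingLimit.Theorems.IsingBoundaryRatio

end
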